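import Literature.Analysis.DeBrangesSpaces.BurnolXPairingDerivatives
import Literature.Analysis.DeBrangesSpaces.BurnolXPairingKernelDerivatives
import HarnessLib

/-!
# Burnol 2001 (CRAS 333), §1: the vectors `X^λ_{w,k}` as `L²(ℝ)` classes and the pairings as
even-line integrals

Burnol works in `K = L²((0,∞))` with the euclidean pairing `(f, X] = ∫_0^∞ f X`; the tree realises
`K` as the even part of `L²(ℝ)`.  For the assembly of Théorème 1.5 one needs the vectors
`X^λ_{w,k}` as genuine `L²(ℝ)` functions (even extensions) and the dictionary
`∫_ℝ f·𝟙_{|t|>λ}X(|t|) = 2∫_λ^∞ f X` for even `f`: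

* `memLp_indicator_log_pow_abs_cpow`: `𝟙_{|t|>λ}(log|t|)^k|t|^{−w} ∈ L²(ℝ)` for `Re w > 1/2`
  (the branch `Re w > 1/2`, `X^λ_{w,k}(t) = 𝟙_{t≥λ}(log 1/t)^k t^{−w}` up to the sign `(−1)^k`);
* `memLp_indicator_iteratedDeriv_cosKernel`: `𝟙_{|u|>λ} ∂_w^k C_λ(u,w) ∈ L²(ℝ)` for every `w`
  (the branch `Re w ≤ 1/2`, `X^λ_{w,k}(t) = 𝟙_{t≥λ}(d^k/d^kw)C_λ(t,w)`; Cauchy estimates `O(1/u)`);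
* `integral_mul_indicator_eq_two_mul_setIntegral`: `∫_ℝ f·𝟙_{|t|>λ}g(|t|)… = 2∫_λ^∞ f g` for
  `f` a.e. even and `g` even.

RH-FREE. [cite: Burnol2001CRAS, §1 (TeX l.266–268: "`K = L²(]0,∞[)`, `(φ,ψ] = ∫ φψ`"; l.393–396)]

## References
* [Burnol2001CRAS] J.-F. Burnol, C. R. Acad. Sci. Paris 333 (2001) 201–206, §1 (TeX l.266–268,
  393–400).
-/

open MeasureTheory Set Filter Complex Metric
open scoped Real Topology ENNReal FourierTransform

open Literature.Analysis.DeBrangesSpaces.SonineMellin (cosKernel cosKernel_neg differentiable_cosKernel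
  continuousOn_cosKernel)

namespace Literature.Analysis.DeBrangesSpaces

namespace Burnol2001

/-! ## A. Even-line integrals versus half-line integrals -/

/-- `∫_ℝ φ = ∫_{(0,∞)} (φ(x) + φ(−x)) dx` for integrable `φ`. [folklore] -/
private theorem integral_eq_integral_Ioi_add_neg'' {φ : ℝ → ℂ} (hφ : Integrable φ) :
    ∫ x, φ x = ∫ x in Ioi 0, (φ x + φ (-x)) := by
  have h1 : IntegrableOn φ (Iic 0) := hφ.integrableOn
  have h2 : IntegrableOn φ (Ioi 0) := hφ.integrableOn
  have h3 : IntegrableOn (fun x ↦ φ (-x)) (Ioi 0) := hφ.comp_neg.integrableOn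
  rw [← intervalIntegral.integral_Iic_add_Ioi h1 h2, integral_add h2 h3, add_comm]
  congr 1
  rw [integral_comp_neg_Ioi]; simp

/-- **`∫_ℝ f·𝟙_{|t|>λ}G = 2∫_λ^∞ f·G`** for `f` a.e. even, `G` even, `λ > 0`, the product integrable
(the dictionary between the tree's even `L²(ℝ)` and Burnol's `K = L²((0,∞))`, `(φ,ψ] = ∫_0^∞ φψ`).
[cite: Burnol2001CRAS, §1 (TeX l.266–268)] -/
theorem integral_mul_indicator_eq_two_mul_setIntegral {lam : ℝ} (hlam : 0 < lam) {f G : ℝ → ℂ}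
    (hf : ∀ᵐ x : ℝ, f (-x) = f x) (hG : ∀ x, G (-x) = G x)
    (hint : Integrable fun t : ℝ ↦ f t * Set.indicator {x : ℝ | lam < |x|} G t) :
    ∫ t : ℝ, f t * Set.indicator {x : ℝ | lam < |x|} G t = 2 * ∫ t in Ioi lam, f t * G t := by
  rw [integral_eq_integral_Ioi_add_neg'' hint]
  have hS : ∀ x : ℝ, Set.indicator {x : ℝ | lam < |x|} G (-x) = Set.indicator {x : ℝ | lam < |x|} G x := by
    intro x
    simp only [Set.indicator_apply, mem_setOf_eq, abs_neg, hG]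
  have e1 : ∫ x in Ioi 0, (f x * Set.indicator {x : ℝ | lam < |x|} G x +
      f (-x) * Set.indicator {x : ℝ | lam < |x|} G (-x)) =
      ∫ x in Ioi 0, 2 * (f x * Set.indicator {x : ℝ | lam < |x|} G x) := by
    refine integral_congr_ae ?_
    filter_upwards [ae_restrict_of_ae (s := Ioi 0) hf] with x hx
    rw [hx, hS]; ring
  rw [e1, integral_const_mul]
  congr 1
  have hI : IntegrableOn (fun t : ℝ ↦ f t * Set.indicator {x : ℝ | lam < |x|} G t) (Ioi 0) :=
    hint.integrableOn
  rw [← Ioc_union_Ioi_eq_Ioi hlam.le, setIntegral_union (Set.Ioc_disjoint_Ioi le_rfl)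
    measurableSet_Ioi (hI.mono_set Ioc_subset_Ioi_self) (hI.mono_set (Ioi_subset_Ioi hlam.le))]
  have e2 : ∫ x in Ioc 0 lam, f x * Set.indicator {x : ℝ | lam < |x|} G x = 0 := by
    refine integral_eq_zero_of_ae ?_
    filter_upwards [ae_restrict_mem measurableSet_Ioc] with x hx
    have hx' : x ∉ {x : ℝ | lam < |x|} := by
      simp only [mem_setOf_eq, not_lt]; rw [abs_of_pos hx.1]; exact hx.2
    rw [Pi.zero_apply, Set.indicator_of_notMem hx', mul_zero]
  rw [e2, zero_add]
  refine setIntegral_congr_fun measurableSet_Ioi (fun x hx ↦ ?_)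
  have hx' : x ∈ {x : ℝ | lam < |x|} := by
    simp only [mem_setOf_eq]; rwa [abs_of_pos (hlam.trans hx)]
  rw [Set.indicator_of_mem hx']

/-! ## B. Even extensions of half-line `L²` functions -/

/-- **An even function, measurable and square-integrable on `(λ,∞)`, gives the `L²(ℝ)` vector
`𝟙_{|t|>λ}G`** — the isometric identification of Burnol's `K = L²(]0,∞[, dt)` with the even part of
`L²(ℝ)` used throughout the tree's typing of the Note. [cite: Burnol2001CRAS, §1 (TeX l.266–268)] -/
theorem memLp_indicator_of_even {lam : ℝ} {G : ℝ → ℂ} (hG : ∀ x, G (-x) = G x)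
    (hGm : AEStronglyMeasurable G (volume.restrict (Ioi lam)))
    (h2 : Integrable (fun x ↦ ‖G x‖ ^ 2) (volume.restrict (Ioi lam))) :
    MemLp (Set.indicator {x : ℝ | lam < |x|} G) 2 (volume : Measure ℝ) := by
  have hSm : MeasurableSet {x : ℝ | lam < |x|} := measurableSet_lt measurable_const continuous_abs.measurable
  have hset : {x : ℝ | lam < |x|} = Iio (-lam) ∪ Ioi lam := by
    ext x; simp only [mem_setOf_eq, mem_union, mem_Iio, mem_Ioi, lt_abs, lt_neg]; tauto
  have hneg : MeasurePreserving (fun x : ℝ ↦ -x) volume volume := Measure.measurePreserving_neg _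
  have hemb : MeasurableEmbedding (fun x : ℝ ↦ -x) := (Homeomorph.neg ℝ).measurableEmbedding
  have hpre : (fun x : ℝ ↦ -x) ⁻¹' Ioi lam = Iio (-lam) := by
    ext x; simp only [mem_preimage, mem_Ioi, mem_Iio, lt_neg]
  have hGeq : (G ∘ fun x : ℝ ↦ -x) = G := funext fun x ↦ hG x
  -- measurability on `(−∞,−λ)` by reflection
  have hmp : MeasurePreserving (fun x : ℝ ↦ -x) (volume.restrict (Iio (-lam))) (volume.restrict (Ioi lam)) := by
    rw [← hpre]; exact hneg.restrict_preimage_emb hemb (Ioi lam)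
  have hGm' : AEStronglyMeasurable G (volume.restrict (Iio (-lam))) := by
    have := hGm.comp_measurePreserving hmp
    rwa [hGeq] at this
  have hGmS : AEStronglyMeasurable (Set.indicator {x : ℝ | lam < |x|} G) volume := by
    rw [aestronglyMeasurable_indicator_iff hSm, hset]
    exact aestronglyMeasurable_union_iff.2 ⟨hGm', hGm⟩
  rw [memLp_two_iff_integrable_sq_norm hGmS]
  have hI : IntegrableOn (fun x ↦ ‖G x‖ ^ 2) {x : ℝ | lam < |x|} := by
    rw [hset]
    refine IntegrableOn.union ?_ h2
    have h2' : IntegrableOn (fun x ↦ ‖G x‖ ^ 2) (Ioi lam) volume := h2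
    have h3 := (hneg.integrableOn_comp_preimage hemb).2 h2'
    rw [hpre] at h3
    exact h3.congr_fun (fun x _ ↦ by simp only [Function.comp_apply, hG]) measurableSet_Iio
  refine ((integrable_indicator_iff hSm).2 hI).congr (Eventually.of_forall fun x ↦ ?_)
  simp only [Set.indicator_apply]
  split_ifs <;> simp

/-! ## C. The vectors `𝟙_{|t|>λ}(log|t|)^k|t|^{−w}` (`Re w > 1/2`) and `𝟙_{|u|>λ}∂_w^kC_λ(u,w)` -/

/-- `|log t| ≤ (t^η + t^{−η})/η`-type bound: `|log t|^n ≤ (2/η)^n (t^{nη} + t^{−nη})`, `t, η > 0`.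
[folklore] -/
private theorem abs_log_pow_le'' {t η : ℝ} (ht : 0 < t) (hη : 0 < η) (n : ℕ) :
    |Real.log t| ^ n ≤ (2 / η) ^ n * (t ^ (n * η) + t ^ (-(n * η))) := by
  have h1 : 0 ≤ t ^ η := Real.rpow_nonneg ht.le _
  have h2 : 0 ≤ t ^ (-η) := Real.rpow_nonneg ht.le _
  have h3 : |Real.log t| ≤ (t ^ η + t ^ (-η)) / η := by
    rcases le_or_gt 1 t with h | h
    · rw [abs_of_nonneg (Real.log_nonneg h)]
      calc Real.log t ≤ t ^ η / η := Real.log_le_rpow_div ht.le hη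
        _ ≤ (t ^ η + t ^ (-η)) / η := by gcongr; linarith
    · rw [abs_of_neg (Real.log_neg ht h), ← Real.log_inv]
      calc Real.log t⁻¹ ≤ t⁻¹ ^ η / η := Real.log_le_rpow_div (inv_nonneg.2 ht.le) hη
        _ = t ^ (-η) / η := by rw [Real.inv_rpow ht.le, Real.rpow_neg ht.le]
        _ ≤ (t ^ η + t ^ (-η)) / η := by gcongr; linarith
  have h4 : |Real.log t| ^ n ≤ ((t ^ η + t ^ (-η)) / η) ^ n :=
    pow_le_pow_left₀ (abs_nonneg _) h3 n
  have h5 : (t ^ η + t ^ (-η)) ^ n ≤ 2 ^ n * ((t ^ η) ^ n + (t ^ (-η)) ^ n) := by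
    calc (t ^ η + t ^ (-η)) ^ n ≤ 2 ^ (n - 1) * ((t ^ η) ^ n + (t ^ (-η)) ^ n) := add_pow_le h1 h2 n
      _ ≤ 2 ^ n * ((t ^ η) ^ n + (t ^ (-η)) ^ n) :=
          mul_le_mul_of_nonneg_right (pow_le_pow_right₀ (by norm_num : (1 : ℝ) ≤ 2) (Nat.sub_le n 1))
            (by positivity)
  rw [← Real.rpow_natCast (t ^ η), ← Real.rpow_natCast (t ^ (-η)), ← Real.rpow_mul ht.le,
    ← Real.rpow_mul ht.le] at h5
  calc |Real.log t| ^ n ≤ ((t ^ η + t ^ (-η)) / η) ^ n := h4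
    _ = (t ^ η + t ^ (-η)) ^ n / η ^ n := by rw [div_pow]
    _ ≤ 2 ^ n * (t ^ (η * n) + t ^ (-η * n)) / η ^ n := by gcongr
    _ = (2 / η) ^ n * (t ^ (n * η) + t ^ (-(n * η))) := by
        rw [div_pow, mul_comm η n, show -η * (n : ℝ) = -(n * η) by ring]; ring

/-- `∫_λ^∞ |log t|^{2k} t^{−2σ} dt < ∞` for `σ > 1/2`, `λ > 0`. [folklore] -/
private theorem integrableOn_abs_log_pow_mul_rpow' {lam : ℝ} (hlam : 0 < lam) (m : ℕ) {p : ℝ}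
    (hp : p < -1) : IntegrableOn (fun t : ℝ ↦ |Real.log t| ^ m * t ^ p) (Ioi lam) := by
  have hcont : ContinuousOn (fun t : ℝ ↦ |Real.log t| ^ m * t ^ p) (Ioi lam) := by
    intro t ht
    have ht0 : t ≠ 0 := (hlam.trans ht).ne'
    exact (((Real.continuousAt_log ht0).abs.pow m).mul
      (Real.continuousAt_rpow_const _ _ (Or.inl ht0))).continuousWithinAt
  set η : ℝ := (-1 - p) / (m + 1) with hη
  have hη0 : 0 < η := by rw [hη]; exact div_pos (by linarith) (by positivity)
  have hmη : m * η < -1 - p := by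
    rw [hη, mul_div_assoc', div_lt_iff₀ (by positivity)]; nlinarith
  have hp1 : m * η + p < -1 := by linarith
  have hp2 : -(m * η) + p < -1 := by
    have : 0 ≤ m * η := by positivity
    linarith
  have hI : IntegrableOn (fun t : ℝ ↦ (2 / η) ^ m * (t ^ (m * η + p) + t ^ (-(m * η) + p))) (Ioi lam) :=
    ((integrableOn_Ioi_rpow_of_lt hp1 hlam).add (integrableOn_Ioi_rpow_of_lt hp2 hlam)).const_mul _
  refine hI.mono' (hcont.aestronglyMeasurable measurableSet_Ioi) ?_
  filter_upwards [ae_restrict_mem measurableSet_Ioi] with t ht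
  have ht0 : 0 < t := hlam.trans ht
  have hr : 0 ≤ t ^ p := Real.rpow_nonneg ht0.le _
  rw [Real.norm_eq_abs, abs_mul, abs_pow, abs_abs, abs_of_nonneg hr]
  calc |Real.log t| ^ m * t ^ p
      ≤ (2 / η) ^ m * (t ^ (m * η) + t ^ (-(m * η))) * t ^ p :=
        mul_le_mul_of_nonneg_right (abs_log_pow_le'' ht0 hη0 m) hr
    _ = (2 / η) ^ m * (t ^ (m * η + p) + t ^ (-(m * η) + p)) := by
        rw [mul_assoc, add_mul, ← Real.rpow_add ht0, ← Real.rpow_add ht0]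

/-- **`𝟙_{|t|>λ}(log|t|)^k|t|^{−w} ∈ L²(ℝ)`** for `Re w > 1/2`, `λ > 0`: the even extension of Burnol's
`X^λ_{w,k}(t) = 𝟙_{t≥λ}(log 1/t)^k t^{−w}` (up to the sign `(−1)^k`).
[cite: Burnol2001CRAS, §1 (TeX l.393–396)] -/
theorem memLp_indicator_log_pow_abs_cpow {lam : ℝ} (hlam : 0 < lam) (k : ℕ) {w : ℂ}
    (hw : 1 / 2 < w.re) :
    MemLp (Set.indicator {x : ℝ | lam < |x|} fun x : ℝ ↦
      ((Real.log |x| : ℝ) : ℂ) ^ k * ((|x| : ℝ) : ℂ) ^ (-w)) 2 (volume : Measure ℝ) := by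
  refine memLp_indicator_of_even (fun x ↦ by simp only [abs_neg]) ?_ ?_
  · refine ContinuousOn.aestronglyMeasurable (fun x hx ↦ ?_) measurableSet_Ioi
    have hx0 : |x| ≠ 0 := (hlam.trans (lt_of_lt_of_le hx (le_abs_self x))).ne'
    refine ContinuousAt.continuousWithinAt ?_
    refine ((Complex.continuous_ofReal.continuousAt.comp
      ((Real.continuousAt_log hx0).comp continuous_abs.continuousAt)).pow k).mul ?_
    exact (Complex.continuousAt_ofReal_cpow_const _ _ (Or.inr hx0)).comp continuous_abs.continuousAt
  · have hI := integrableOn_abs_log_pow_mul_rpow' hlam (2 * k) (p := -(2 * w.re)) (by linarith)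
    refine hI.congr_fun (fun x hx ↦ ?_) measurableSet_Ioi
    have hx0 : 0 < x := hlam.trans hx
    dsimp only
    rw [norm_mul, norm_pow, Complex.norm_real, Real.norm_eq_abs, abs_of_pos hx0,
      Complex.norm_cpow_eq_rpow_re_of_pos hx0, Complex.neg_re, mul_pow, ← pow_mul,
      ← Real.rpow_natCast (x ^ (-w.re)), ← Real.rpow_mul hx0.le]
    congr 1
    · rw [mul_comm]
    · norm_num; ring

/-- `u ↦ ∂_w^k C_a(u,w)` is measurable on `(b,∞)` (pointwise limit of difference quotients of
functions continuous in `u`). [folklore] -/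
private theorem aestronglyMeasurable_iteratedDeriv_cosKernel' {a b : ℝ} (ha : 0 < a) (hb : 0 < b)
    (k : ℕ) (w : ℂ) :
    AEStronglyMeasurable (fun u : ℝ ↦ iteratedDeriv k (cosKernel a u) w) (volume.restrict (Ioi b)) := by
  induction k generalizing w with
  | zero =>
    simp only [iteratedDeriv_zero]
    exact ((continuousOn_cosKernel ha w).mono fun u hu ↦ (hb.trans hu).ne').aestronglyMeasurable
      measurableSet_Ioi
  | succ k ih =>
    set h : ℕ → ℂ := fun n ↦ ((1 / ((n : ℝ) + 1) : ℝ) : ℂ) with hh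
    have hh0 : ∀ n, h n ≠ 0 := fun n ↦ by
      have h1 : (1 / ((n : ℝ) + 1) : ℝ) ≠ 0 := by positivity
      rw [hh]
      exact Complex.ofReal_ne_zero.2 h1
    have hlim : Tendsto h atTop (𝓝[≠] 0) := by
      refine tendsto_nhdsWithin_iff.2 ⟨?_, Eventually.of_forall fun n ↦ hh0 n⟩
      have := (Complex.continuous_ofReal.tendsto 0).comp tendsto_one_div_add_atTop_nhds_zero_nat
      rwa [Complex.ofReal_zero] at this
    refine aestronglyMeasurable_of_tendsto_ae atTop
      (f := fun n u ↦ (h n)⁻¹ • (iteratedDeriv k (cosKernel a u) (w + h n) -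
        iteratedDeriv k (cosKernel a u) w)) (fun n ↦ ?_) ?_
    · exact ((ih (w + h n)).sub (ih w)).const_smul ((h n)⁻¹)
    filter_upwards [ae_restrict_mem measurableSet_Ioi] with u hu
    have hu0 : u ≠ 0 := (hb.trans hu).ne'
    rw [iteratedDeriv_succ]
    have hd := ((differentiable_iteratedDeriv_cosKernel ha hu0 k) w).hasDerivAt
    rw [hasDerivAt_iff_tendsto_slope_zero] at hd
    have := hd.comp hlim
    refine this.congr fun n ↦ ?_
    simp only [Function.comp_apply]

/-- **`𝟙_{|u|>λ} ∂_w^k C_a(u,w) ∈ L²(ℝ)`** for every `w` (`a, λ > 0`): the even extension of Burnol's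
`X^λ_{w,k}(t) = 𝟙_{t≥λ}(d^k/d^kw)C_λ(t,w)` (Cauchy estimates `O(1/u)`).
[cite: Burnol2001CRAS, §1 and Lemme 1.3 (TeX l.358–367, 393–396)] -/
theorem memLp_indicator_iteratedDeriv_cosKernel {a lam : ℝ} (ha : 0 < a) (hlam : 0 < lam) (k : ℕ)
    (w : ℂ) :
    MemLp (Set.indicator {x : ℝ | lam < |x|} fun u : ℝ ↦ iteratedDeriv k (cosKernel a u) w) 2
      (volume : Measure ℝ) := by
  have heven : ∀ u : ℝ, iteratedDeriv k (cosKernel a (-u)) w = iteratedDeriv k (cosKernel a u) w := by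
    intro u
    have : cosKernel a (-u) = cosKernel a u := funext fun z ↦ cosKernel_neg a u z
    rw [this]
  refine memLp_indicator_of_even heven (aestronglyMeasurable_iteratedDeriv_cosKernel' ha hlam k w) ?_
  obtain ⟨K, hK0, hK⟩ := exists_bound_iteratedDeriv_cosKernel ha hlam k ‖w‖
  have hI : IntegrableOn (fun u : ℝ ↦ K ^ 2 * u ^ (-2 : ℝ)) (Ioi lam) :=
    (integrableOn_Ioi_rpow_of_lt (by norm_num : (-2 : ℝ) < -1) hlam).const_mul (K ^ 2)
  refine hI.mono' ((aestronglyMeasurable_iteratedDeriv_cosKernel' ha hlam k w).norm.pow 2) ?_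
  filter_upwards [ae_restrict_mem measurableSet_Ioi] with u hu
  have hu0 : 0 < u := hlam.trans hu
  have h1 := hK u w (by rw [abs_of_pos hu0]; exact hu.le) le_rfl
  rw [abs_of_pos hu0] at h1
  rw [Real.norm_eq_abs, abs_pow, abs_norm]
  have h2 : ‖iteratedDeriv k (cosKernel a u) w‖ ^ 2 ≤ (K / u) ^ 2 :=
    pow_le_pow_left₀ (norm_nonneg _) h1 2
  calc ‖iteratedDeriv k (cosKernel a u) w‖ ^ 2 ≤ (K / u) ^ 2 := h2
    _ = K ^ 2 * u ^ (-2 : ℝ) := by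
        rw [div_pow, Real.rpow_neg hu0.le, show (2 : ℝ) = ((2 : ℕ) : ℝ) by norm_num,
          Real.rpow_natCast, div_eq_mul_inv]

end Burnol2001

end Literature.Analysis.DeBrangesSpaces
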